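import Summits.Ventures.CertifiedManyBodySolver.Theorems.TcThermcert1HighTempTermBounds
import Summits.Ventures.CertifiedManyBodySolver.Theorems.TcThermcert1HighTempClusterCount
import HarnessLib

/-!
# High-temperature current clustering for TcThermcert1's Hypothesis C — part 4b: the cluster sum and the graph-level bound

Helper file for route `TcThermcert1` (crux K1′ `ThermalStiffnessCeilingU8b8_le_7o44`, item `stmt-Ventures-24560`; line
`Cruxes/ThermalStiffnessCeilingU8b8_le_7o44/Lines/gauge_qbp_far_seam.lean`, small-`β` rung `stub_currentClustering8_smallBeta`).

* §1 geometry of the terms on a graph of maximal degree `Δ`: `ShareVertex`-neighbour lists of size `≤ 2(2Δ+1)`, at most `2Δ+1` terms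
  through a site, terms of `D`-diameter `≤ 1` for any "distance" `D` with `D ≤ 1` on edges; an admissible set of terms reaching a site at
  `D`-distance `≥ d` from both roots has at least `d` terms;
* §2 **the graph-level canonical current clustering bound** (cluster sum of part 2c `TcThermcert1HighTempClusterCount.lean`): for `β ≥ 0` with `λ(β) = β e^{(β+1)E} e^{2β(2Δ+1)E} ≤ λ₁`, every spin sector
  `(M,N)`, every even observable `A` of `X` and every bond `{a,b}` at `D`-distance `≥ d` from `X`:
  `|tr(P_{M,N} e^{−βH} A j_{ab})| ≤ 16 e^{2β(2Δ+1)E} (1 + (2Δ+1)·2√λ₁)² (λ(β)/λ₁)^d ‖A‖ Re tr(P_{M,N} e^{−βH})`, and `tr(P_{M,N} e^{−βH} j_{ab}) = 0`.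

[cite: Ueltschi1999, §2.3]; [cite: FriedliVelenik2017, §5.2, eq. (5.27)]. HONEST FRAMING: a high-temperature estimate for the canonical
Gibbs state of the Hubbard model on a finite graph; nothing here is a `T_c` estimate; K1′/K1 remain CONDITIONAL ceilings; superconductivity
in the Hubbard model is NOT proved here. No definitions; no `sorry`.
-/

noncomputable section

namespace Summit.Ventures.CertifiedManyBodySolver.Theorems.TcThermcert1.HighTempCurrentClustering

open Matrix Finset
open Literature.MathematicalPhysics.QuantumLattice
open Literature.Probability.LatticeModels
open Summit.Ventures.CertifiedManyBodySolver.Theorems.TcThermcert1.GaugeQbpFarSeam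
open Summit.Ventures.CertifiedManyBodySolver.Theorems.TcThermcert1.FreeGasCurrentClustering
open scoped Matrix.Norms.L2Operator ComplexOrder Classical

variable {Λ : Type*} [LinearOrder Λ] [Fintype Λ] (G : SimpleGraph Λ) [DecidableRel G.Adj] (t U μ : ℝ)

/-! ## §1 Geometry of the terms -/

/-- `ShareVertex`-neighbour lists of the terms: a term shares a site with at most `2(2Δ+1)` terms. [folklore] -/
theorem card_shareVertex_nbr_le {Δ : ℕ} (hΔ : ∀ x : Λ, (Finset.univ.filter fun y => G.Adj x y).card ≤ Δ) (Z : HubbardIdx G) :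
    (Finset.univ.filter fun Z' : HubbardIdx G => ¬ Disjoint (hubbardTermSupp G Z') (hubbardTermSupp G Z)).card ≤ 2 * (2 * Δ + 1) :=
  (card_filter_not_disjoint_hubbardTermSupp_le G hΔ _).trans (Nat.mul_le_mul_right _ (card_hubbardTermSupp_le_two G Z))

/-- Terms sharing a vertex are in each other's neighbour lists. [folklore] -/
theorem mem_nbr_of_shareVertex (Z Z' : HubbardIdx G)
    (h : ShareVertex (hubbardTermSupp G) Z Z') :
    Z' ∈ Finset.univ.filter fun Z' : HubbardIdx G => ¬ Disjoint (hubbardTermSupp G Z') (hubbardTermSupp G Z) := by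
  refine Finset.mem_filter.2 ⟨Finset.mem_univ _, fun hd => ?_⟩
  obtain ⟨x, hx⟩ := h
  exact Finset.disjoint_left.1 hd (Finset.mem_inter.1 hx).2 (Finset.mem_inter.1 hx).1

/-- At most `2Δ+1` terms pass through a site. [folklore] -/
theorem card_terms_through_le {Δ : ℕ} (hΔ : ∀ x : Λ, (Finset.univ.filter fun y => G.Adj x y).card ≤ Δ) (x : Λ) :
    ((Finset.univ : Finset (HubbardIdx G)).filter fun Z => x ∈ hubbardTermSupp G Z).card ≤ 2 * Δ + 1 := by
  have hsub : (Finset.univ : Finset (HubbardIdx G)).filter (fun Z => x ∈ hubbardTermSupp G Z) ⊆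
      Finset.univ.filter (fun Z : HubbardIdx G => ¬ Disjoint (hubbardTermSupp G Z) {x}) := by
    intro Z hZ
    refine Finset.mem_filter.2 ⟨Finset.mem_univ _, fun hd => ?_⟩
    exact Finset.disjoint_left.1 hd (Finset.mem_filter.1 hZ).2 (Finset.mem_singleton_self x)
  refine (Finset.card_le_card hsub).trans ((card_filter_not_disjoint_hubbardTermSupp_le G hΔ {x}).trans ?_)
  rw [Finset.card_singleton, one_mul]

omit [Fintype Λ] [DecidableRel G.Adj] in
/-- Terms have `D`-diameter `≤ 1` for every `D` vanishing on the diagonal and `≤ 1` on edges. [folklore] -/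
theorem termDiam_le_one (D : Λ → Λ → ℕ) (hD0 : ∀ x, D x x = 0) (hadj : ∀ x y, G.Adj x y → D x y ≤ 1) (Z : HubbardIdx G) :
    ∀ y ∈ hubbardTermSupp G Z, ∀ y' ∈ hubbardTermSupp G Z, D y y' ≤ 1 := by
  intro y hy y' hy'
  rcases eq_or_adj_of_mem_hubbardTermSupp G hy hy' with rfl | h
  · rw [hD0]; exact Nat.zero_le _
  · exact hadj y y' h

omit [Fintype Λ] [DecidableRel G.Adj] in
/-- **A set of terms through which a far site is reachable is large**: if `x` is at `D`-distance `≥ d` from both roots and reachable from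
`{a,b}` through `K`, then `d ≤ |K|`. [folklore] -/
theorem le_card_of_reach (D : Λ → Λ → ℕ) (hD0 : ∀ x, D x x = 0) (htri : ∀ x y z, D x z ≤ D x y + D y z)
    (hadj : ∀ x y, G.Adj x y → D x y ≤ 1) {a b : Λ} {K : Finset (HubbardIdx G)} {x : Λ} {d : ℕ}
    (hd : d ≤ D a x ∧ d ≤ D b x)
    (hx : ∃ r ∈ ({a, b} : Finset Λ), Relation.ReflTransGen
      (fun x y : Λ => ∃ Z ∈ K, x ∈ hubbardTermSupp G Z ∧ y ∈ hubbardTermSupp G Z) r x) : d ≤ K.card := by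
  obtain ⟨r, hr, hrx⟩ := exists_root_dist_le_card D hD0 htri (termDiam_le_one G D hD0 hadj) hx
  rcases Finset.mem_insert.1 hr with rfl | hr
  · exact hd.1.trans hrx
  · rw [Finset.mem_singleton.1 hr] at hrx
    exact hd.2.trans hrx

/-! ## §2 The graph-level canonical current clustering bound -/

/-- **The projected current expectation vanishes** (time reversal): `tr(P_{M,N} e^{−βH} j_{ab}) = 0`. [folklore] -/
theorem trace_proj_gibbsWeight_current_eq_zero (β : ℝ) (a b : Λ) (M N : ℕ) :
    (spinSectorProj M N * gibbsWeight β (∑ Z, hubbardTermOp G t U μ Z) *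
        ∑ σ : Fin 2, ((-Complex.I) • (creation (orb a σ) * annihilation (orb b σ)) +
          Complex.I • (creation (orb b σ) * annihilation (orb a σ)))).trace = 0 := by
  rw [Matrix.trace_mul_comm]
  have hPt : (spinSectorProj M N : Matrix (Finset (Orb Λ)) (Finset (Orb Λ)) ℂ)ᵀ = spinSectorProj M N := by
    rw [spinSectorProj, diagonal_transpose]
  have hWt : (gibbsWeight β (∑ Z, hubbardTermOp G t U μ Z))ᵀ = gibbsWeight β (∑ Z, hubbardTermOp G t U μ Z) := by
    rw [gibbsWeight]
    exact transpose_exp_smul_sum_hubbardTermOp G _ t U μ Finset.univ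
  exact trace_mul_eq_zero_of_transpose (transpose_current a b)
    (transpose_mul_of_commute hPt hWt
      (spinSectorProj_mul_gibbsWeight_comm (preservesSectors_sum_hubbardTermOp G t U μ Finset.univ) β M N))

/-- **Graph-level high-temperature canonical current clustering.** On a finite graph of maximal degree `Δ`, with
`E = 2|t| + |U| + 2|μ|`, `0 ≤ β`, `λ(β) := β e^{(β+1)E} e^{2β(2Δ+1)E} ≤ λ₁ ≤ 1`, `(2(2Δ+1)+1)² √λ₁ ≤ 1/2`: for every spin sector `(M,N)`,
every even observable `A` of a site set `X`, and every bond `{a,b}` at `D`-distance `≥ d` from `X` (`D` any "distance" with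
`D x x = 0`, the triangle inequality and `D ≤ 1` on edges),
`|tr(P_{M,N} e^{−βH} A j_{ab})| ≤ 16 e^{2β(2Δ+1)E} (1 + (2Δ+1)·2√λ₁)² (λ(β)/λ₁)^d ‖A‖ Re tr(P_{M,N} e^{−βH})`.
[cite: Ueltschi1999, §2.3 and §3] -/
theorem norm_trace_proj_gibbsWeight_mul_current_le {Δ : ℕ} (hΔ : ∀ x : Λ, (Finset.univ.filter fun y => G.Adj x y).card ≤ Δ)
    (D : Λ → Λ → ℕ) (hD0 : ∀ x, D x x = 0) (htri : ∀ x y z, D x z ≤ D x y + D y z) (hadj : ∀ x y, G.Adj x y → D x y ≤ 1)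
    {β : ℝ} (hβ : 0 ≤ β) (M N : ℕ) {lam₁ : ℝ} (hlam₁ : lam₁ ≤ 1)
    (hsmall : ((2 * (2 * Δ + 1) : ℕ) + 1 : ℝ) ^ 2 * Real.sqrt lam₁ ≤ 1 / 2)
    (hβl : β * Real.exp ((β + 1) * (2 * |t| + |U| + 2 * |μ|)) * Real.exp (2 * β * (2 * Δ + 1 : ℕ) * (2 * |t| + |U| + 2 * |μ|)) ≤ lam₁)
    {X : Finset Λ} {A : Matrix (Finset (Orb Λ)) (Finset (Orb Λ)) ℂ} (hA : A ∈ carEvenSubalgebra (orbSet X))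
    (a b : Λ) {d : ℕ} (hd : ∀ x ∈ X, d ≤ D a x ∧ d ≤ D b x) :
    ‖(spinSectorProj M N * gibbsWeight β (∑ Z, hubbardTermOp G t U μ Z) *
        (A * ∑ σ : Fin 2, ((-Complex.I) • (creation (orb a σ) * annihilation (orb b σ)) +
          Complex.I • (creation (orb b σ) * annihilation (orb a σ))))).trace‖ ≤
      16 * Real.exp (2 * β * (2 * Δ + 1 : ℕ) * (2 * |t| + |U| + 2 * |μ|)) * (1 + (2 * Δ + 1 : ℕ) * (2 * Real.sqrt lam₁)) ^ 2 *
        (β * Real.exp ((β + 1) * (2 * |t| + |U| + 2 * |μ|)) * Real.exp (2 * β * (2 * Δ + 1 : ℕ) * (2 * |t| + |U| + 2 * |μ|)) / lam₁) ^ d *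
        ‖A‖ * ((spinSectorProj M N * gibbsWeight β (∑ Z, hubbardTermOp G t U μ Z)).trace).re := by
  -- abbreviations
  set E : ℝ := 2 * |t| + |U| + 2 * |μ| with hE
  set lam : ℝ := β * Real.exp ((β + 1) * E) * Real.exp (2 * β * (2 * Δ + 1 : ℕ) * E) with hlam
  set Z₀ : ℝ := ((spinSectorProj M N * gibbsWeight β (∑ Z, hubbardTermOp G t U μ Z)).trace).re with hZ₀
  set j : Matrix (Finset (Orb Λ)) (Finset (Orb Λ)) ℂ := ∑ σ : Fin 2, ((-Complex.I) • (creation (orb a σ) * annihilation (orb b σ)) +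
    Complex.I • (creation (orb b σ) * annihilation (orb a σ))) with hj
  have hE0 : 0 ≤ E := by positivity
  have hlam0 : 0 ≤ lam := by positivity
  have hH : (∑ Z, hubbardTermOp G t U μ Z).IsHermitian := isHermitian_sum_hubbardTermOp G t U μ Finset.univ
  have hHP : PreservesSectors (∑ Z, hubbardTermOp G t U μ Z) := preservesSectors_sum_hubbardTermOp G t U μ Finset.univ
  have hZ₀0 : 0 ≤ Z₀ := (Complex.nonneg_iff.1 (posSemidef_spinSectorProj_mul_gibbsWeight hH hHP β M N).trace_nonneg).1
  have hB : ‖A * j‖ ≤ ‖A‖ * 4 := (norm_mul_le _ _).trans (by gcongr; exact norm_farBond_le a b)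
  have hlam₁0 : 0 ≤ lam₁ := hlam0.trans hβl
  -- empty sector: everything vanishes
  by_cases hne : ∃ s : Finset (Orb Λ), (upPart s).card = M ∧ (downPart s).card = N
  swap
  · have hP0 : (spinSectorProj M N : Matrix (Finset (Orb Λ)) (Finset (Orb Λ)) ℂ) = 0 := by
      rw [spinSectorProj]
      ext s s'
      rw [diagonal_apply, Matrix.zero_apply]
      split_ifs with h1 h2
      · exact absurd ⟨s, h2⟩ hne
      · rfl
      · rfl
    rw [hP0, Matrix.zero_mul, Matrix.zero_mul, Matrix.trace_zero, norm_zero]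
    exact mul_nonneg (mul_nonneg (mul_nonneg (by positivity) (pow_nonneg (div_nonneg hlam0 hlam₁0) d)) (norm_nonneg A)) hZ₀0
  -- expansion over the admissible polymers reaching `X`, bounded polymer by polymer
  rw [trace_proj_gibbsWeight_mul_current_eq_sum G t U μ β a b M N hA]
  refine (norm_sum_le _ _).trans ?_
  refine (Finset.sum_le_sum (g := fun K : Finset (HubbardIdx G) =>
    (16 * Real.exp (2 * β * (2 * Δ + 1 : ℕ) * E) * ‖A‖ * Z₀) * lam ^ K.card) fun K _ => ?_).trans ?_
  · -- one polymer `K`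
    have hH' : (∑ Z ∈ Finset.univ.filter (fun Z => ∀ w ∈ hubbardTermSupp G Z, ¬ ∃ r ∈ ({a, b} : Finset Λ),
        Relation.ReflTransGen (fun x y : Λ => ∃ Z ∈ K, x ∈ hubbardTermSupp G Z ∧ y ∈ hubbardTermSupp G Z) r w),
        hubbardTermOp G t U μ Z).IsHermitian := isHermitian_sum_hubbardTermOp G t U μ _
    have hP' : PreservesSectors (∑ Z ∈ Finset.univ.filter (fun Z => ∀ w ∈ hubbardTermSupp G Z, ¬ ∃ r ∈ ({a, b} : Finset Λ),
        Relation.ReflTransGen (fun x y : Λ => ∃ Z ∈ K, x ∈ hubbardTermSupp G Z ∧ y ∈ hubbardTermSupp G Z) r w),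
        hubbardTermOp G t U μ Z) := preservesSectors_sum_hubbardTermOp G t U μ _
    have h1 := norm_trace_term_le G t U μ hβ M N hH' hP' (A * j) K
    have h2 := re_trace_proj_gibbsWeight_le_exp_mul (r := (2 + 2 * K.card) * (2 * Δ + 1) * E) hβ M N hH' hH hP' hHP hne
      (by rw [norm_sub_rev]; exact norm_sum_sub_sum_far_le G t U μ hΔ a b K)
    refine h1.trans ?_
    have hexp : Real.exp (β * ((2 + 2 * K.card) * (2 * Δ + 1) * E)) =
        Real.exp (2 * β * (2 * Δ + 1 : ℕ) * E) * Real.exp (2 * β * (2 * Δ + 1 : ℕ) * E) ^ K.card := by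
      rw [← Real.exp_nat_mul, ← Real.exp_add]
      congr 1
      push_cast
      ring
    have hZ' : 0 ≤ ((spinSectorProj M N * gibbsWeight β (∑ Z ∈ Finset.univ.filter (fun Z => ∀ w ∈ hubbardTermSupp G Z,
        ¬ ∃ r ∈ ({a, b} : Finset Λ), Relation.ReflTransGen
          (fun x y : Λ => ∃ Z ∈ K, x ∈ hubbardTermSupp G Z ∧ y ∈ hubbardTermSupp G Z) r w),
        hubbardTermOp G t U μ Z)).trace).re :=
      (Complex.nonneg_iff.1 (posSemidef_spinSectorProj_mul_gibbsWeight hH' hP' β M N).trace_nonneg).1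
    calc (β * Real.exp ((β + 1) * E)) ^ K.card * ‖A * j‖ *
          ((spinSectorProj M N * gibbsWeight β (∑ Z ∈ Finset.univ.filter (fun Z => ∀ w ∈ hubbardTermSupp G Z,
            ¬ ∃ r ∈ ({a, b} : Finset Λ), Relation.ReflTransGen
              (fun x y : Λ => ∃ Z ∈ K, x ∈ hubbardTermSupp G Z ∧ y ∈ hubbardTermSupp G Z) r w),
            hubbardTermOp G t U μ Z)).trace).re
        ≤ (β * Real.exp ((β + 1) * E)) ^ K.card * (‖A‖ * 4) * (Real.exp (β * ((2 + 2 * K.card) * (2 * Δ + 1) * E)) * Z₀) :=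
          mul_le_mul (mul_le_mul_of_nonneg_left hB (by positivity)) h2 hZ' (by positivity)
      _ = (16 * Real.exp (2 * β * (2 * Δ + 1 : ℕ) * E) * ‖A‖ * Z₀) * lam ^ K.card / 4 := by
          rw [hexp, hlam]
          ring
      _ ≤ (16 * Real.exp (2 * β * (2 * Δ + 1 : ℕ) * E) * ‖A‖ * Z₀) * lam ^ K.card :=
          div_le_self (mul_nonneg (mul_nonneg (mul_nonneg (by positivity) (norm_nonneg A)) hZ₀0) (pow_nonneg hlam0 _))
            (by norm_num)
  · -- the cluster sum
    rw [← Finset.mul_sum]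
    have hsum := sum_admissible_reaching_pow_le (verts := hubbardTermSupp G) (card_shareVertex_nbr_le G hΔ)
      (mem_nbr_of_shareVertex G) D hD0 htri (termDiam_le_one G D hD0 hadj) Finset.univ a b
      (card_terms_through_le G hΔ a) (card_terms_through_le G hΔ b) hd hlam0 hβl hlam₁ hsmall
    have hC0 : 0 ≤ 16 * Real.exp (2 * β * (2 * Δ + 1 : ℕ) * E) * ‖A‖ * Z₀ :=
      mul_nonneg (mul_nonneg (by positivity) (norm_nonneg A)) hZ₀0
    calc (16 * Real.exp (2 * β * (2 * Δ + 1 : ℕ) * E) * ‖A‖ * Z₀) * _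
        ≤ (16 * Real.exp (2 * β * (2 * Δ + 1 : ℕ) * E) * ‖A‖ * Z₀) *
            ((lam / lam₁) ^ d * (1 + (2 * Δ + 1 : ℕ) * (2 * Real.sqrt lam₁)) ^ 2) := by
          refine mul_le_mul_of_nonneg_left ?_ hC0
          convert hsum using 4
          rfl
      _ = _ := by ring

end Summit.Ventures.CertifiedManyBodySolver.Theorems.TcThermcert1.HighTempCurrentClustering

end
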